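import Literature.MathematicalPhysics.KineticTheory.InfiniteChainSuperstableReversal
import Literature.MathematicalPhysics.KineticTheory.FluctuationAbelPositivity
import HarnessLib

/-!
# Transport regularity of a regular state from zero-wavenumber data (reduction)

Topic `Literature/MathematicalPhysics/KineticTheory` (companion of `ZeroWavenumberSpace`,
`FluctuationAbelPositivity`, `InfiniteChainSuperstableReversal`). For the infinite chain
`P : OscillatorChain` with a dynamics `D : InfiniteChainDynamics P`, the two TRANSPORT REGULARITY
properties of a state `μ` consumed by Abelian Green–Kubo statements —
(i) `D.HasAbsConvergentCorrelation μ t` at every `t` (absolutely convergent space-summed current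
autocorrelation `C_μ(t) = Σ_x ∫ j₀ (j_x ∘ φ_t) dμ`), and
(ii) positivity of the Abel functional `∫₀^∞ e^{-νt} C_μ(t) dt` for every `ν > 0` —
both follow once `μ` is the state of a `ZeroWavenumberData P D` (Doyon's summable space-time
clustering of a shift- and flow-stable space of local observables containing `j₀`, `h₀`) with zero
mean current, a strongly continuous Koopman group on `ℋ₀(μ)` and `C_μ(0) > 0`:
(i) is the clustering of the current class (`ZeroWavenumberData.hasAbsConvergentCorrelation`), (ii) is
`∫₀^∞ e^{-νt}⟪[J], U_t[J]⟫₀ dt = ν‖(ν - L)⁻¹[J]‖² > 0` (`abelFunctional_pos_of_currentCorrelation_zero_pos`).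
The zero-mean-current input is automatic for a state in a REGULAR CLASS with at most one element
(DLR at `T` + shift-invariant + Buttà–Marchioro's superstability estimate; momentum-reversal symmetry,
`integral_bondCurrentZ_eq_zero_of_regular_unique`), which is the form in which the statement is used
for the pinned anharmonic chain (`transportRegular_of_regular_unique`). Everything is proved; tagged
`[folklore]`. No definitions, no named facts.
-/

noncomputable section

open MeasureTheory Filter Set Function

namespace Literature.MathematicalPhysics.KineticTheory.HeatConduction

namespace ZeroWavenumberData

variable {P : OscillatorChain} {D : InfiniteChainDynamics P} (Z : ZeroWavenumberData P D)

/-- **Transport regularity from zero-wavenumber data (zero mean current form).** If the mean current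
vanishes, the Koopman group on `ℋ₀(μ)` is strongly continuous and `C_μ(0) > 0`, then the summed
current autocorrelation converges absolutely at every time and the Abel functional is positive at
every `ν > 0`. [folklore] -/
theorem transportRegular (hmean : ∫ σ, P.bondCurrentZ σ 0 ∂Z.μ = 0)
    (hU : Z.toFluctuationDynamics.IsStronglyContinuous) (h0 : 0 < D.currentCorrelation Z.μ 0) :
    (∀ t : ℝ, D.HasAbsConvergentCorrelation Z.μ t) ∧
      ∀ ν : ℝ, 0 < ν → 0 < ∫ t in Ioi (0 : ℝ), Real.exp (-(ν * t)) * D.currentCorrelation Z.μ t :=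
  ⟨fun t => Z.hasAbsConvergentCorrelation hmean t,
    fun _ hν => Z.abelFunctional_pos_of_currentCorrelation_zero_pos hU hmean h0 hν⟩

/-- The same with `[J] ≠ 0` in place of `C_μ(0) > 0` (`C_μ(0) = ‖[J]‖²`). [folklore] -/
theorem transportRegular' (hmean : ∫ σ, P.bondCurrentZ σ 0 ∂Z.μ = 0)
    (hU : Z.toFluctuationDynamics.IsStronglyContinuous) (hJ : Z.currentClass ≠ 0) :
    (∀ t : ℝ, D.HasAbsConvergentCorrelation Z.μ t) ∧
      ∀ ν : ℝ, 0 < ν → 0 < ∫ t in Ioi (0 : ℝ), Real.exp (-(ν * t)) * D.currentCorrelation Z.μ t :=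
  ⟨fun t => Z.hasAbsConvergentCorrelation hmean t, fun _ hν => Z.abelFunctional_pos hU hmean hJ hν⟩

/-- **Transport regularity from zero-wavenumber data (momentum-reversal form).** [folklore] -/
theorem transportRegular_of_hasMomentumReversal (hR : Z.HasMomentumReversal)
    (hU : Z.toFluctuationDynamics.IsStronglyContinuous) (h0 : 0 < D.currentCorrelation Z.μ 0) :
    (∀ t : ℝ, D.HasAbsConvergentCorrelation Z.μ t) ∧
      ∀ ν : ℝ, 0 < ν → 0 < ∫ t in Ioi (0 : ℝ), Real.exp (-(ν * t)) * D.currentCorrelation Z.μ t :=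
  Z.transportRegular (Z.integral_bondCurrent_eq_zero hR) hU h0

/-- **Transport regularity of the regular state (reduction used for the pinned anharmonic chain).**
If the state of the zero-wavenumber data is a DLR Gibbs state of `P` at temperature `T`,
shift-invariant and superstable, and the regular class at `T` has at most one element (hypothesis
`huniq`; the printed 1-D DLR uniqueness theorem, not in the tree), then — given strong continuity of
the Koopman group on `ℋ₀(μ)` and `C_μ(0) > 0` — clauses (i) and (ii) hold: absolutely convergent
summed current autocorrelation at every `t` and a positive Abel functional at every `ν > 0`
(zero mean current comes from the momentum-reversal symmetry forced by uniqueness). [folklore] -/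
theorem transportRegular_of_regular_unique {T : ℝ} (hG : P.IsChainGibbsMeasure T Z.μ)
    (hS : IsShiftInvariant Z.μ) (hss : P.HasSuperstabilityEstimate Z.μ)
    (huniq : ∀ μ₁ μ₂ : Measure ChainConfig,
      P.IsChainGibbsMeasure T μ₁ → IsShiftInvariant μ₁ → P.HasSuperstabilityEstimate μ₁ →
      P.IsChainGibbsMeasure T μ₂ → IsShiftInvariant μ₂ → P.HasSuperstabilityEstimate μ₂ → μ₁ = μ₂)
    (hU : Z.toFluctuationDynamics.IsStronglyContinuous) (h0 : 0 < D.currentCorrelation Z.μ 0) :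
    (∀ t : ℝ, D.HasAbsConvergentCorrelation Z.μ t) ∧
      ∀ ν : ℝ, 0 < ν → 0 < ∫ t in Ioi (0 : ℝ), Real.exp (-(ν * t)) * D.currentCorrelation Z.μ t :=
  Z.transportRegular (OscillatorChain.integral_bondCurrentZ_eq_zero_of_regular_unique hG hS hss huniq 0)
    hU h0

end ZeroWavenumberData

end Literature.MathematicalPhysics.KineticTheory.HeatConduction

end
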